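import Mathlib
import HarnessLib
import Summits.Schanuel.Schanuel.Theses.AdelicLogSector
import Literature.NumberTheory.EllipticCurves.PAdicHeights

/-!
# Line `birth` — BC3 skeleton for the crux `TransferModP` (stmt-Schanuel-7088)

Route `AdelicLogSector` (route-Schanuel-AdelicLogSector), crux of rank 2,
`Summit.Schanuel.Schanuel.Theses.AdelicLogSector.TransferModP` (TRANSFER, mod-`p` shadow):
for distinct primes `ℓ₁,…,ℓ_r`, an integer polynomial `P` whose homogeneous components below degree
`d` vanish and with `P(log ℓ₁,…,log ℓ_r) = 0` in `ℝ` has `P_d(q_p(ℓ₁),…,q_p(ℓ_r)) ≡ 0 (mod p)` for all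
large primes `p`, where `q_p(ℓ) = (ℓ^{p−1} − 1)/p` is the Fermat quotient and `P_d` the degree-`d`
homogeneous component.

THE LINE (the route header's own "NOT DECOMPOSED YET" item, now typed): the crux is the FIRST `p`-ADIC
DIGIT of the `p`-adic transfer statement, and the passage from the `p`-adic statement to the digit is a
pair of honest, provable lemmas. With `log_p` the Iwasawa logarithm of the tree
(`Literature.NumberTheory.EllipticCurves.padicLog`, defined through the logarithmic series on principal
units, `log_p x = (p−1)⁻¹·L(u^{p−1})`):

* `stub_padicTransfer` (LOAD-BEARING, OPEN — this is where the crux lives): a polynomial relation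
  `P(log ℓ₁,…,log ℓ_r) = 0` among real logarithms of distinct primes also holds among their Iwasawa
  `p`-adic logarithms, `P(log_p ℓ₁,…,log_p ℓ_r) = 0` in `ℚ_p`, for all sufficiently large `p`. This is
  "ker ev_∞ ⊆ ker ev_p" on the ring generated by the logarithm symbols of the Kummer 1-motives
  `[ℤ → 𝔾_m, 1 ↦ ℓᵢ]`, whose archimedean period is `log ℓᵢ` and whose André `p`-adic period is
  `log_p(ℓᵢ^{1−p})/(1−p) = log_p ℓᵢ` (arXiv:2207.09213 Ex. 9.6, §8; arXiv:2510.20525 §4.1); it is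
  implied by the sector conjecture `PrimeLogSector` (an injective real evaluation kills `P`), exactly as the
  crux is (route support `TransferOfPrimeLogSector`), so it is irrefutable short of refuting the sector; in
  degree one it is a theorem at both places (vacuous over `ℚ`). It is STRONGER than the crux (all digits,
  not the first), and that is the point of the line: its natural habitat — `p`-adic periods / the ring
  `∏_p ℚ_p ⧸ ⊕_p ℚ_p` of "all large `p`" — has structure (period formalism, Frobenius) that a bare
  congruence among Fermat quotients does not.
* `stub_padicLog_fermatQuotient` (TRUE, size M — `p`-adic analysis over Mathlib's `ℚ_[p]`): for a prime
  `p ≥ 3` and `p ∤ ℓ`, `log_p ℓ = −p·t` with `t ∈ ℤ_p` and `t ≡ q_p(ℓ) (mod p)` — "the Fermat quotient is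
  the first digit of the Iwasawa logarithm". Proof sketch: `ℓ^{p−1} = 1 + p·q` exactly (`q = q_p(ℓ) ∈ ℕ`),
  the series `L(1 + pq) = Σ_{k≥1} (−1)^{k+1}(pq)^k/k` converges in `ℚ_p` with every term of index `k ≥ 2`
  in `p²ℤ_p` (needs `p ≥ 3`: for `p = 2` the `k = 2` term spoils it and the statement is false), and
  `(p−1)⁻¹ ≡ −1 (mod p)`. Leans on: the tree definition `padicLog`/`padicLogSeries`
  (Literature/NumberTheory/EllipticCurves/PAdicHeights.lean, Iwasawa1972PadicL §4.4), Mathlib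
  `PadicInt.toZMod`, summability in complete nonarchimedean groups.
* `stub_lowestComponent_modP` (TRUE, size M — `MvPolynomial` algebra): if the homogeneous components of
  `P ∈ ℤ[X₁..X_r]` below degree `d` vanish and `P(−p·t₁,…,−p·t_r) = 0` in `ℚ_p` with `tᵢ ∈ ℤ_p`, then
  `P_d(t̄₁,…,t̄_r) = 0` in `ℤ/p` (`t̄ = t mod p`). Proof sketch: by homogeneity
  `P(−p·t) = Σ_{e ≥ d} (−p)^e P_e(t) = (−p)^d·(P_d(t) + p·s)` with `s ∈ ℤ_p`; `ℚ_p` is a domain, so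
  `P_d(t) = −p·s ∈ pℤ_p`, and `PadicInt.toZMod` is a ring map killing `p` that commutes with `aeval`.
  (This is the computation `P(log_p ℓ⃗) ≡ (−p)^d P_d(q_p ℓ⃗) (mod p^{d+1})` of the crux's docstring.)

Composition (sorry-free, standard axioms): `transferModP_of_stubs` takes the three stub STATEMENTS as
hypotheses (verbatim) and proves the UNFOLDED crux: given the data, `stub_padicTransfer` yields `p₀`; for a
prime `p ≥ p₀ + 3 + Σᵢ ℓᵢ` one has `p ≥ 3` and `p ∤ ℓᵢ` (`ℓᵢ ≤ Σ ℓ < p`), so `stub_padicLog_fermatQuotient`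
writes `log_p ℓᵢ = −p·tᵢ` with `tᵢ mod p = q_p(ℓᵢ)`; substituting into the `p`-adic relation and applying
`stub_lowestComponent_modP` gives `P_d(q_p(ℓ⃗)) = 0` in `ZMod p`. `TransferModP_of : TransferModP` is the
crux BY NAME (the only theorem of this file whose head is the crux decl); `sorry` occurs ONLY inside the
three `stub_*` theorems.

Disproof used: none exists for this crux (`ledger crux ls stmt-Schanuel-7088`: no workfiles; no
`Theorems/TransferModP/Negative/*`). Refuter/grounder notes on the item (2026-08-15): elaborates, degenerate
cases (`r = 0`, `d = 0`, `p = ℓᵢ` junk quotient, `p = 2`) clean, irrefutable short of `¬PrimeLogSector`;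
restatement risk acknowledged. This line honours those notes: the junk prime `p = ℓᵢ` and `p = 2` are
excluded by the choice `p₀ + 3 + Σ ℓᵢ`, and no stub is the sector conjecture or the crux reworded —
stub 1 is the `p`-adic (all-digit) statement, stubs 2–3 are theorems-to-be.
-/

-- `Summit.<Summit>.<Problem>`: for the single-conjunct summit `Schanuel` the duplicate is mandated.
set_option linter.dupNamespace false
set_option linter.unusedVariables false

open scoped BigOperators

namespace Summit.Schanuel.Schanuel.Cruxes.TransferModP.Birth

open Summit.Schanuel.Schanuel.Theses.AdelicLogSector (TransferModP)

/-! ## The three registered stubs (statements fully spelled out; registered verbatim) -/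

/-- **Stub 1 — `p`-adic transfer of polynomial relations among logarithms of primes** (LOAD-BEARING,
OPEN; implied by `PrimeLogSector`). For distinct primes `ℓᵢ` and `P ∈ ℤ[X₁..X_r]` with
`P(log ℓ₁,…,log ℓ_r) = 0` in `ℝ`, there is `p₀` such that `P(log_p ℓ₁,…,log_p ℓ_r) = 0` in `ℚ_p` for every
prime `p ≥ p₀`, `log_p` the Iwasawa logarithm `Literature.NumberTheory.EllipticCurves.padicLog`. Why it might
fail: nothing is known to transfer an ACCIDENTAL archimedean relation to the crystalline realisation; degree
one is vacuous over `ℚ`; it may be exactly as hard as the sector conjecture that implies it. Sources: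
arXiv:2207.09213 (Ex. 9.6, §8 `p`-adic period conjecture), arXiv:2510.20525 (§4.1), arXiv:2411.03118,
Bombieri1981 (global relations among G-function values as the proved model of "transfer"). -/
theorem stub_padicTransfer :
    ∀ (r : ℕ) (ℓ : Fin r → ℕ), (∀ i, (ℓ i).Prime) → Function.Injective ℓ →
      ∀ P : MvPolynomial (Fin r) ℤ,
        MvPolynomial.aeval (fun i => Real.log (ℓ i)) P = 0 →
        ∃ p₀ : ℕ, ∀ (p : ℕ) [Fact p.Prime], p₀ ≤ p →
          MvPolynomial.aeval
            (fun i => Literature.NumberTheory.EllipticCurves.padicLog p ((ℓ i : ℕ) : ℚ_[p])) P = 0 := by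
  sorry

/-- **Stub 2 — the Fermat quotient is the first digit of the Iwasawa logarithm** (TRUE; size M).
For a prime `p ≥ 3` and a natural number `ℓ` with `p ∤ ℓ`: `log_p ℓ = −p·t` for some `t ∈ ℤ_p` with
`t mod p = q_p(ℓ) = (ℓ^{p−1} − 1)/p (mod p)`. (`ℓ^{p−1} = 1 + p·q_p(ℓ)` exactly by Fermat, the logarithmic
series of `1 + p·q` is `≡ p·q (mod p²)` for `p ≥ 3`, and `(p − 1)⁻¹ ≡ −1 (mod p)`; false for `p = 2`.)
Leans on: `Literature.NumberTheory.EllipticCurves.padicLog` / `padicLogSeries` (Iwasawa1972PadicL §4.4),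
Mathlib `PadicInt.toZMod`, `ZMod.pow_card_sub_one_eq_one`. Sources: Iwasawa1972PadicL; Eisenstein 1850 /
Silverman1988 (Fermat quotient as a logarithm). -/
theorem stub_padicLog_fermatQuotient :
    ∀ (p : ℕ) [Fact p.Prime], 3 ≤ p → ∀ ℓ : ℕ, ¬ p ∣ ℓ →
      ∃ t : ℤ_[p],
        Literature.NumberTheory.EllipticCurves.padicLog p (ℓ : ℚ_[p]) = -((p : ℚ_[p]) * (t : ℚ_[p])) ∧
        PadicInt.toZMod t = (((ℓ ^ (p - 1) - 1) / p : ℕ) : ZMod p) := by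
  sorry

/-- **Stub 3 — the lowest homogeneous component under `p`-scaling** (TRUE; size M). If the homogeneous
components of `P ∈ ℤ[X₁..X_r]` below degree `d` vanish and `P(−p·t₁,…,−p·t_r) = 0` in `ℚ_p` with all
`tᵢ ∈ ℤ_p`, then the degree-`d` component satisfies `P_d(t̄₁,…,t̄_r) = 0` in `ZMod p`:
`P(−p·t) = (−p)^d (P_d(t) + p·s)`, `s ∈ ℤ_p`, and `ℚ_p` is a domain. Leans on: Mathlib
`MvPolynomial.sum_homogeneousComponent`, `MvPolynomial.IsHomogeneous`, `PadicInt.toZMod`,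
`MvPolynomial.map_aeval`/`eval₂_comp_left`. Sources: folklore (the `(−p)^d P_d(q_p) (mod p^{d+1})`
computation recorded in the crux docstring). -/
theorem stub_lowestComponent_modP :
    ∀ (p : ℕ) [Fact p.Prime] (r : ℕ) (P : MvPolynomial (Fin r) ℤ) (d : ℕ),
      (∀ k < d, MvPolynomial.homogeneousComponent k P = 0) →
      ∀ t : Fin r → ℤ_[p],
        MvPolynomial.aeval (fun i => -((p : ℚ_[p]) * (t i : ℚ_[p]))) P = 0 →
        MvPolynomial.aeval (fun i => PadicInt.toZMod (t i))
          (MvPolynomial.homogeneousComponent d P) = 0 := by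
  sorry

/-! ## The composition: stub statements ⟹ the crux (sorry-free, standard axioms) -/

/-- **The real composition.** From the three stub statements (taken as hypotheses, verbatim) the
UNFOLDED crux follows: `h1` gives `p₀`; for a prime `p ≥ p₀ + 3 + Σᵢ ℓᵢ` we have `3 ≤ p` and `p ∤ ℓᵢ`
for every `i` (`0 < ℓᵢ ≤ Σ ℓ < p`), so `h2` provides `tᵢ ∈ ℤ_p` with `log_p ℓᵢ = −p·tᵢ` and
`tᵢ mod p = q_p(ℓᵢ)`; rewriting the `p`-adic relation and applying `h3` yields `P_d(q_p ℓ⃗) = 0` in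
`ZMod p`. The conclusion is deliberately the unfolded crux so that `TransferModP_of` below is the only
theorem whose head is the crux decl. [folklore] -/
theorem transferModP_of_stubs
    (h1 : ∀ (r : ℕ) (ℓ : Fin r → ℕ), (∀ i, (ℓ i).Prime) → Function.Injective ℓ →
      ∀ P : MvPolynomial (Fin r) ℤ,
        MvPolynomial.aeval (fun i => Real.log (ℓ i)) P = 0 →
        ∃ p₀ : ℕ, ∀ (p : ℕ) [Fact p.Prime], p₀ ≤ p →
          MvPolynomial.aeval
            (fun i => Literature.NumberTheory.EllipticCurves.padicLog p ((ℓ i : ℕ) : ℚ_[p])) P = 0)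
    (h2 : ∀ (p : ℕ) [Fact p.Prime], 3 ≤ p → ∀ ℓ : ℕ, ¬ p ∣ ℓ →
      ∃ t : ℤ_[p],
        Literature.NumberTheory.EllipticCurves.padicLog p (ℓ : ℚ_[p]) = -((p : ℚ_[p]) * (t : ℚ_[p])) ∧
        PadicInt.toZMod t = (((ℓ ^ (p - 1) - 1) / p : ℕ) : ZMod p))
    (h3 : ∀ (p : ℕ) [Fact p.Prime] (r : ℕ) (P : MvPolynomial (Fin r) ℤ) (d : ℕ),
      (∀ k < d, MvPolynomial.homogeneousComponent k P = 0) →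
      ∀ t : Fin r → ℤ_[p],
        MvPolynomial.aeval (fun i => -((p : ℚ_[p]) * (t i : ℚ_[p]))) P = 0 →
        MvPolynomial.aeval (fun i => PadicInt.toZMod (t i))
          (MvPolynomial.homogeneousComponent d P) = 0) :
    ∀ (r : ℕ) (ℓ : Fin r → ℕ), (∀ i, (ℓ i).Prime) → Function.Injective ℓ →
      ∀ (P : MvPolynomial (Fin r) ℤ) (d : ℕ),
        (∀ k < d, MvPolynomial.homogeneousComponent k P = 0) →
        MvPolynomial.aeval (fun i => Real.log (ℓ i)) P = 0 →
        ∃ p₀ : ℕ, ∀ p : ℕ, p₀ ≤ p → p.Prime →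
          MvPolynomial.aeval (fun i => ((((ℓ i) ^ (p - 1) - 1) / p : ℕ) : ZMod p))
            (MvPolynomial.homogeneousComponent d P) = 0 := by
  intro r ℓ hℓ hinj P d hlow hP
  obtain ⟨p₀, hp₀⟩ := h1 r ℓ hℓ hinj P hP
  refine ⟨p₀ + 3 + ∑ i, ℓ i, fun p hp hprime => ?_⟩
  haveI : Fact p.Prime := ⟨hprime⟩
  have h3p : 3 ≤ p := by omega
  have hp₀p : p₀ ≤ p := by omega
  have hndvd : ∀ i, ¬ p ∣ ℓ i := by
    intro i hdiv
    have hle : ℓ i ≤ ∑ j, ℓ j :=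
      Finset.single_le_sum (f := ℓ) (fun j _ => Nat.zero_le (ℓ j)) (Finset.mem_univ i)
    have hle' : p ≤ ℓ i := Nat.le_of_dvd (hℓ i).pos hdiv
    omega
  choose t ht using fun i => h2 p h3p (ℓ i) (hndvd i)
  have hrel := hp₀ p hp₀p
  have hfun : (fun i => Literature.NumberTheory.EllipticCurves.padicLog p ((ℓ i : ℕ) : ℚ_[p])) =
      fun i => -((p : ℚ_[p]) * (t i : ℚ_[p])) := funext fun i => (ht i).1
  rw [hfun] at hrel
  have hmod := h3 p r P d hlow t hrel
  have hfun2 : (fun i => PadicInt.toZMod (t i)) =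
      fun i => ((((ℓ i) ^ (p - 1) - 1) / p : ℕ) : ZMod p) := funext fun i => (ht i).2
  rw [hfun2] at hmod
  exact hmod

/-- **THE skeleton theorem** — the crux `TransferModP` BY NAME from the three declared stubs via the
sorry-free composition `transferModP_of_stubs` (`ledger skeleton check` shape: no hypotheses; `sorry`
enters only through `stub_padicTransfer`, `stub_padicLog_fermatQuotient`, `stub_lowestComponent_modP`).
[folklore] -/
theorem TransferModP_of : TransferModP :=
  transferModP_of_stubs stub_padicTransfer stub_padicLog_fermatQuotient stub_lowestComponent_modP

end Summit.Schanuel.Schanuel.Cruxes.TransferModP.Birth
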